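import Mathlib.GroupTheory.QuotientGroup.Defs
import Literature.Combinatorics.Additive.TPPGroupAlgebra
import Literature.Computability.AlgebraicComplexity.CohnUmansTPP
import HarnessLib

/-!
# Realizing `⟨n, m, p⟩` under permutations and group extensions (Cohn–Umans 2003, Lemmas 2.1–2.2)

Topic `Literature/Computability/AlgebraicComplexity` (group-theoretic matrix multiplication), namespace
`Literature.Computability.AlgebraicComplexity`; companion of `CohnUmansTPP.lean` (`RealizesTPP`, Cohn–Umans
Def. 2.1) and `Literature/Combinatorics/Additive/TripleProductProperty.lean` (`TripleProductProperty`).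

H. Cohn, C. Umans, *A group-theoretic approach to fast matrix multiplication*, FOCS 2003 = arXiv:math/0307321
(held text `paper:arxiv-math_0307321`, p. 4 of the materialised text; the arXiv text numbers the two lemmas
"Lemma 1" and "Lemma 2"):

* **Lemma 2.1** "If `G` realizes `⟨n₁,n₂,n₃⟩`, then it does so for every permutation of `n₁,n₂,n₃`."
  (proof: "Conjugating by `s₁'s₁⁻¹` … so we can perform a cyclic shift. To get a transposition, we take the
  inverse of the initial equation … a transposition of `1` with `3`") — `RealizesTPP.rotate`,
  `RealizesTPP.reverse`, `CohnUmans2003_lemma21` (all five non-trivial orderings).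
* **Lemma 2.2** "If `N` is a normal subgroup of `G` that realizes `⟨n₁, n₂, n₃⟩` and `G/N` realizes
  `⟨m₁, m₂, m₃⟩`, then `G` realizes `⟨n₁m₁, n₂m₂, n₃m₃⟩`." (proof: "suppose `T₁,T₂,T₃` are lifts to `G` of the
  three subsets of `G/N` … `G` realizes … through the pointwise products `S₁T₁, S₂T₂, S₃T₃` … If we reduce this
  equation modulo `N`, we find that `tᵢ = tᵢ'` modulo `N`, and hence also in `G`. The equation in `G` then
  becomes `s₁'s₁⁻¹ s₂'s₂⁻¹ s₃'s₃⁻¹ = 1`, from which we deduce `sᵢ = sᵢ'`") — `CohnUmans2003_lemma22`, with the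
  lift realised by a set-theoretic section of `G → G/N` (`Function.surjInv`).
* transport along injective homomorphisms / from subgroups (`RealizesTPP.map_of_injective`,
  `RealizesTPP.of_subgroup`; the case `m = (1,1,1)` of Lemma 2.2 without normality).

The printed "useful special case" (`G₁ × G₂` realizes `⟨n₁n₂, m₁m₂, p₁p₂⟩`) is the census file
`Summits/MatrixMultiplication/OmegaCensus/DirectProductTPP.lean` (`realizesTPP_prod`) and is not re-declared.

## References
* H. Cohn, C. Umans, FOCS 2003, 438–449; arXiv:math/0307321, §2: Def. 2.1, Lemma 2.1, Lemma 2.2 (Lemmas 1–2 of the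
  arXiv text, p. 4). [CohnUmans2003]
-/

namespace Literature.Computability.AlgebraicComplexity

open Literature.Combinatorics.Additive

variable {G : Type*} [Group G]

/-- `RealizesTPP G n m p` is literally "some `S, T, U` of sizes `n, m, p` have the tree's
`TripleProductProperty`" (Cohn–Umans Def. 2.1, both files spell out the same right-quotient clause).
[cite: CohnUmans2003, Def. 2.1] -/
theorem realizesTPP_iff {n m p : ℕ} :
    RealizesTPP G n m p ↔
      ∃ S T U : Finset G, S.card = n ∧ T.card = m ∧ U.card = p ∧ TripleProductProperty S T U :=
  Iff.rfl

/-! ## Lemma 2.1: permutations -/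

/-- Cyclic shift: `G` realizes `⟨n₁,n₂,n₃⟩` ⇒ `G` realizes `⟨n₂,n₃,n₁⟩` ("Conjugating by `s₁'s₁⁻¹` shows … we
can perform a cyclic shift"; the tree's `TripleProductProperty.rotate`).
[cite: CohnUmans2003, Lemma 2.1 (Lemma 1 of the arXiv text, p. 4)] -/
theorem RealizesTPP.rotate {n₁ n₂ n₃ : ℕ} (h : RealizesTPP G n₁ n₂ n₃) : RealizesTPP G n₂ n₃ n₁ := by
  obtain ⟨S, T, U, hS, hT, hU, h⟩ := h
  exact ⟨T, U, S, hT, hU, hS, TripleProductProperty.rotate h⟩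

/-- Reversal (the transposition `1 ↔ 3`): `G` realizes `⟨n₁,n₂,n₃⟩` ⇒ `G` realizes `⟨n₃,n₂,n₁⟩` ("we take
the inverse of the initial equation … the roles of `s` and `s'` have been reversed, but that is irrelevant").
[cite: CohnUmans2003, Lemma 2.1 (Lemma 1 of the arXiv text, p. 4)] -/
theorem RealizesTPP.reverse {n₁ n₂ n₃ : ℕ} (h : RealizesTPP G n₁ n₂ n₃) : RealizesTPP G n₃ n₂ n₁ := by
  obtain ⟨S, T, U, hS, hT, hU, h⟩ := h
  refine ⟨U, T, S, hU, hT, hS, ?_⟩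
  intro u hu u' hu' t ht t' ht' s hs s' hs' heq
  -- invert: `(u u'⁻¹ · t t'⁻¹ · s s'⁻¹)⁻¹ = s' s⁻¹ · t' t⁻¹ · u' u⁻¹ = 1`
  have heq' : s' * s⁻¹ * (t' * t⁻¹) * (u' * u⁻¹) = 1 := by
    have := congrArg (·⁻¹) heq
    simpa [mul_inv_rev, mul_assoc] using this
  obtain ⟨h1, h2, h3⟩ := h s' hs' s hs t' ht' t ht u' hu' u hu heq'
  exact ⟨h3.symm, h2.symm, h1.symm⟩

/-- **Cohn–Umans 2003, Lemma 2.1**: "If `G` realizes `⟨n₁,n₂,n₃⟩`, then it does so for every permutation of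
`n₁,n₂,n₃`" — the five non-trivial orderings, generated by the cyclic shift and the transposition `1 ↔ 3`.
[cite: CohnUmans2003, Lemma 2.1 (Lemma 1 of the arXiv text, p. 4)] -/
theorem CohnUmans2003_lemma21 {n₁ n₂ n₃ : ℕ} (h : RealizesTPP G n₁ n₂ n₃) :
    RealizesTPP G n₂ n₃ n₁ ∧ RealizesTPP G n₃ n₁ n₂ ∧ RealizesTPP G n₃ n₂ n₁ ∧
      RealizesTPP G n₂ n₁ n₃ ∧ RealizesTPP G n₁ n₃ n₂ :=
  ⟨h.rotate, h.rotate.rotate, h.reverse, h.rotate.rotate.reverse, h.rotate.reverse⟩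

/-! ## Transport along injective homomorphisms -/

/-- A TPP triple is carried to a TPP triple of the same sizes by an injective homomorphism (the condition
`q₁q₂q₃ = 1 ⇒ qᵢ = 1` is reflected by an injective hom); in particular subgroups pass realizations up.
[cite: CohnUmans2003, Def. 2.1] -/
theorem RealizesTPP.map_of_injective {H : Type*} [Group H] (f : G →* H) (hf : Function.Injective f)
    {n m p : ℕ} (h : RealizesTPP G n m p) : RealizesTPP H n m p := by
  obtain ⟨S, T, U, hS, hT, hU, h⟩ := h
  refine ⟨S.map ⟨f, hf⟩, T.map ⟨f, hf⟩, U.map ⟨f, hf⟩, by rw [Finset.card_map, hS],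
    by rw [Finset.card_map, hT], by rw [Finset.card_map, hU], ?_⟩
  intro s hs s' hs' t ht t' ht' u hu u' hu' heq
  simp only [Finset.mem_map, Function.Embedding.coeFn_mk] at hs hs' ht ht' hu hu'
  obtain ⟨s, hs, rfl⟩ := hs
  obtain ⟨s', hs', rfl⟩ := hs'
  obtain ⟨t, ht, rfl⟩ := ht
  obtain ⟨t', ht', rfl⟩ := ht'
  obtain ⟨u, hu, rfl⟩ := hu
  obtain ⟨u', hu', rfl⟩ := hu'
  have key : f (s * s'⁻¹ * (t * t'⁻¹) * (u * u'⁻¹)) = f 1 := by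
    simpa only [map_mul, map_inv, map_one] using heq
  obtain ⟨h1, h2, h3⟩ := h s hs s' hs' t ht t' ht' u hu u' hu' (hf key)
  exact ⟨congrArg f h1, congrArg f h2, congrArg f h3⟩

/-- If a subgroup `N ≤ G` realizes `⟨n, m, p⟩` then so does `G` (Lemma 2.2 with `G/N ⊇ {1}` realizing
`⟨1,1,1⟩`, but without normality). [cite: CohnUmans2003, Lemma 2.2 (Lemma 2 of the arXiv text, p. 4)] -/
theorem RealizesTPP.of_subgroup (N : Subgroup G) {n m p : ℕ} (h : RealizesTPP N n m p) :
    RealizesTPP G n m p :=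
  h.map_of_injective N.subtype N.subtype_injective

/-! ## Lemma 2.2: extensions -/

/-- **Cohn–Umans 2003, Lemma 2.2**: "If `N` is a normal subgroup of `G` that realizes `⟨n₁, n₂, n₃⟩` and `G/N`
realizes `⟨m₁, m₂, m₃⟩`, then `G` realizes `⟨n₁m₁, n₂m₂, n₃m₃⟩`" — through the pointwise products `SᵢTᵢ`
with `Tᵢ` lifts (along a section `σ` of `G → G/N`) of the subsets of `G/N`: reducing the TPP equation modulo
`N` gives `tᵢ = tᵢ'`, and then it reads `s₁'s₁⁻¹ s₂'s₂⁻¹ s₃'s₃⁻¹ = 1` in `N`.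
[cite: CohnUmans2003, Lemma 2.2 (Lemma 2 of the arXiv text, p. 4)] -/
theorem CohnUmans2003_lemma22 (N : Subgroup G) [N.Normal] {n₁ n₂ n₃ m₁ m₂ m₃ : ℕ}
    (hN : RealizesTPP N n₁ n₂ n₃) (hQ : RealizesTPP (G ⧸ N) m₁ m₂ m₃) :
    RealizesTPP G (n₁ * m₁) (n₂ * m₂) (n₃ * m₃) := by
  classical
  obtain ⟨S₁, S₂, S₃, hS₁, hS₂, hS₃, hS⟩ := hN
  obtain ⟨T₁, T₂, T₃, hT₁, hT₂, hT₃, hT⟩ := hQ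
  -- the projection and a section
  set φ : G →* G ⧸ N := QuotientGroup.mk' N with hφdef
  have hφ : Function.Surjective φ := QuotientGroup.mk'_surjective N
  set σ : G ⧸ N → G := Function.surjInv hφ with hσdef
  have hσ : ∀ q, φ (σ q) = q := Function.surjInv_eq hφ
  have hφN : ∀ s : N, φ (s : G) = 1 := fun s => by
    rw [hφdef, QuotientGroup.mk'_apply, QuotientGroup.eq_one_iff]; exact s.2
  have hφlift : ∀ (s : N) (q : G ⧸ N), φ ((s : G) * σ q) = q := fun s q => by
    rw [map_mul, hφN, one_mul, hσ]
  -- the lifted product sets `S·σ(T)`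
  let lift : Finset N → Finset (G ⧸ N) → Finset G := fun S T =>
    (S ×ˢ T).image fun x => (x.1 : G) * σ x.2
  have card_lift : ∀ (S : Finset N) (T : Finset (G ⧸ N)), (lift S T).card = S.card * T.card := by
    intro S T
    rw [← Finset.card_product]
    refine Finset.card_image_of_injOn ?_
    rintro ⟨s, q⟩ _ ⟨s', q'⟩ _ h
    have hq : q = q' := by
      have := congrArg φ h
      rwa [hφlift, hφlift] at this
    subst hq
    have hs : (s : G) = s' := mul_right_cancel h
    exact Prod.ext (Subtype.ext hs) rfl
  have mem_lift : ∀ {S : Finset N} {T : Finset (G ⧸ N)} {a : G},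
      a ∈ lift S T → ∃ s ∈ S, ∃ q ∈ T, (s : G) * σ q = a := by
    intro S T a ha
    obtain ⟨⟨s, q⟩, hx, rfl⟩ := Finset.mem_image.1 ha
    rw [Finset.mem_product] at hx
    exact ⟨s, hx.1, q, hx.2, rfl⟩
  refine ⟨lift S₁ T₁, lift S₂ T₂, lift S₃ T₃, by rw [card_lift, hS₁, hT₁], by rw [card_lift, hS₂, hT₂],
    by rw [card_lift, hS₃, hT₃], ?_⟩
  intro a₁ ha₁ a₁' ha₁' a₂ ha₂ a₂' ha₂' a₃ ha₃ a₃' ha₃' heq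
  obtain ⟨s₁, hs₁, q₁, hq₁, rfl⟩ := mem_lift ha₁
  obtain ⟨s₁', hs₁', q₁', hq₁', rfl⟩ := mem_lift ha₁'
  obtain ⟨s₂, hs₂, q₂, hq₂, rfl⟩ := mem_lift ha₂
  obtain ⟨s₂', hs₂', q₂', hq₂', rfl⟩ := mem_lift ha₂'
  obtain ⟨s₃, hs₃, q₃, hq₃, rfl⟩ := mem_lift ha₃
  obtain ⟨s₃', hs₃', q₃', hq₃', rfl⟩ := mem_lift ha₃'
  -- "If we reduce this equation modulo `N`, we find that `tᵢ = tᵢ'`"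
  have hmod : q₁ * q₁'⁻¹ * (q₂ * q₂'⁻¹) * (q₃ * q₃'⁻¹) = 1 := by
    have := congrArg φ heq
    simpa only [map_mul, map_inv, map_one, hφN, one_mul, hσ] using this
  obtain ⟨e₁, e₂, e₃⟩ := hT q₁ hq₁ q₁' hq₁' q₂ hq₂ q₂' hq₂' q₃ hq₃ q₃' hq₃' hmod
  subst e₁ e₂ e₃
  -- "The equation in `G` then becomes `s₁'s₁⁻¹ s₂'s₂⁻¹ s₃'s₃⁻¹ = 1`" (here: `sᵢ sᵢ'⁻¹`, inside `N`)
  have cancel : ∀ (x x' : N) (q : G ⧸ N),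
      (x : G) * σ q * ((x' : G) * σ q)⁻¹ = ((x * x'⁻¹ : N) : G) := by
    intro x x' q
    rw [mul_inv_rev, Subgroup.coe_mul, Subgroup.coe_inv, ← mul_assoc, mul_assoc (x : G), mul_inv_cancel,
      mul_one]
  rw [cancel, cancel, cancel] at heq
  have hN1 : s₁ * s₁'⁻¹ * (s₂ * s₂'⁻¹) * (s₃ * s₃'⁻¹) = 1 := by exact_mod_cast heq
  obtain ⟨h1, h2, h3⟩ := hS s₁ hs₁ s₁' hs₁' s₂ hs₂ s₂' hs₂' s₃ hs₃ s₃' hs₃' hN1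
  subst h1 h2 h3
  exact ⟨rfl, rfl, rfl⟩

end Literature.Computability.AlgebraicComplexity
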